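/-
Copyright (c) 2026. Released under the Apache 2.0 license.
NS-CLAIMS SWEEP (D-0090) — C91 `Feinstein2025` (T3 QUICK tranche tail, RULINGS v1.29s (2)). SKELETON (conv. (a)).
-/
import Mathlib
import Literature.Claims.NS.ClayVariants
import HarnessLib

/-!
# C91 — I. Feinstein, «Global Regularity for 3D Navier–Stokes via Restricted, NSE-Native Carleson Control at the Active Scale» (2025)

Zenodo 17281263 (doi:10.5281/zenodo.17281263; = SSRN 5448454, whose record title differs: «… Unconditional
Global Regularity via Resonant Budgets, Variable-Axis Conic Analysis, and Small-Scale Absorption»).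
Text of record = the Zenodo v2 deposit: MAIN `NSE_CLAY.pdf` (4 pp., dated 6 Oct 2025; "main p.N") and
APPENDIX `NSE_CLAY_PROOFS.pdf` (4 pp., author line «Author Name»; "app. p.N"); PDF page = printed page
(sources/Feinstein2025/Zenodo-17281263/). Bib `Feinstein2025`. WHAT THIS IS NOT: not a claim about NS
regularity or blow-up; not a claim about any author beyond the typed locator. QUICK row: the claimed
theorem over the Clay schema + the printed two-line composition at the ABSTRACT grain (real functions of
time); nothing asserted, records proved.

## The claim as printed
Theorem 7.1 (Smooth continuation), main p.3: «Let u₀ ∈ H¹(ℝ³) ∩ L²(ℝ³), divergence-free. Then the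
solution u of NSE satisfies ∫₀^T ‖ω(t)‖_{L^∞} dt < ∞ and extends smoothly beyond T. Thus
u ∈ C^∞(ℝ³ × [0,∞)).» Proof (complete, 2 lines): «From Theorem 6.2 and conic Bernstein estimate
‖ω‖_{L^∞} ≲ F(t), Grönwall yields F(t) < ∞ and integrability of ‖ω‖_{L^∞}. Beale–Kato–Majda implies
smooth continuation.» Abstract main p.1: «… unconditional smooth continuation.»

## Ordered step index (the printed composition; first failing step = earliest false one)
* Step 1 `Step1_CLI_goodSlabs` — Theorem 6.2 (CLI inequality) main p.3: «On good slabs, …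
  d/dt F(t) + c Σ_j 2^{2j}‖U_j‖²_{L²} ≤ C Φ(t) F(t), Φ ∈ L¹(0,T)», good = Standing Assumption 2.1 (Good
  patch) main p.2: «(i) ⨍_{Q_r}|ω|² ≤ ε₀²; (ii) gap_{r_j} ≥ γ_j r_j⁻¹ on the active set»; proof 4 lines
  («Φ collects L¹ contributions from commutators, off-diagonal and bad cones»). Typed at the ABSTRACT
  grain as the hypothesis package of Step 3 (the functional `F(t) = Σ_j 2^{3j/2}‖P_{e,j}Δ_j u‖₂` of
  Def. 3.2 is not typed — QUICK): a differential inequality for `F ≥ 0` on a «good» time set `G ⊆ (0,T)`.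
* Step 2 `Step2_Packing` — appendix §5 «Parabolic packing ()» app. p.3 (4 sentences, theorem title empty,
  invoking «the restricted-axis Carleson estimate (Theorem ??)»): «Build a Whitney decomposition of the bad
  set B … The contribution of each Whitney box is controlled by the local energy … Summing shows
  ∫₀^T Φ dt ≲ c_pack (‖u‖²_{L^∞_t L²_x} + ‖∇u‖²_{L²_{t,x}})» — `Φ ∈ L¹(0,T)` from the ENERGY. Typed
  abstractly as the integrability hypothesis of Step 3 (no kernel object: `Φ` is not defined in print
  beyond «collects … contributions»).
* Step 3 `Step3_GronwallOnGoodSlabs_abs` — **proof of Thm 7.1 line 1, main p.3** (= app. §7 p.4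
  «Assume ∫₀^T Φ dt < ∞. Grönwall implies F* ∈ L^∞(0,T)»): from Step 1 (inequality ON GOOD SLABS) and
  Step 2 (`Φ ∈ L¹`), «Grönwall yields F(t) < ∞» on (0,T). AS USED: the inequality is available only on
  the good set `G`; no printed sentence makes every slab good. Abstract grain, kernel-checkable
  (typist kit: `G = ∅`, `F(t) = 1/(T − t)`).
* Step 4 `Step4_BernsteinBKM_abs` — proof of Thm 7.1 line 1–2: «conic Bernstein estimate ‖ω‖_{L^∞} ≲
  F(t)» + bounded `F` ⇒ `∫₀^T‖ω‖_{L^∞} < ∞` (abstract: a function dominated by a bounded one on a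
  finite interval is integrable — measurability being given). True-type.
* Step 5 `Step5_Bridge` — «Beale–Kato–Majda implies smooth continuation. Thus u ∈ C^∞(ℝ³ × [0,∞))»:
  Steps 3–4 (for the paper's `F`, `Φ`, `ω` of every solution) ⇒ `ClaimedTheorem` (BKM [literature] +
  local theory, invoked).
`claim_of_steps : Step3 → Step4 → Step5 → ClaimedTheorem` (all binders consumed).

## Clay delta (reference `ClayVariants`)
Nearest (A). Δ1 `ℝ³` = · Δ2 = · Δ3 `f ≡ 0` = · Δ4 data «H¹ ∩ L², divergence-free» ⊋ Clay (4) (stronger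
claim; NB for non-smooth `H¹` data the printed «u ∈ C^∞(ℝ³ × [0,∞))» fails at `t = 0` as worded — a
statement slip; typed at the Clay data class) · Δ5/Δ6: no pressure regularity and no bounded-energy
clause printed → `ClayDelta`, `clay_of_claimed_of_delta` PROVED. Δ7: the whole text is CONDITIONAL on
Standing Assumption 2.1 («good patch») while the abstract says «unconditional» — recorded at Step 3.

## Kill / certificate kit (typist QC; not part of this file)
`claims/Feinstein2025/SoloRefuteFeinstein2025.draft.lean`: `not_Step3_GronwallOnGoodSlabs_abs` (T = 1,
G = ∅, Φ ≡ 0, F(t) = 1/(1 − t), C = c = 0: every hypothesis holds, F is unbounded on (0,1)).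
-/

open scoped ContDiff
open Set MeasureTheory

namespace Literature.Claims.NS.Feinstein2025

open Literature.Analysis.FluidPDE Literature.Claims.NS.ClayVariants

/-- `ℝ³` (plumbing). [folklore] -/
abbrev E3 := EuclideanSpace ℝ (Fin 3)

/-! ## The claimed statement -/

/-- **Theorem 7.1 (Smooth continuation)** main p.3, typed at the Clay data class (special case of the
printed `u₀ ∈ H¹ ∩ L²`): for every `ν > 0` and every smooth divergence-free rapidly decaying `u₀` there
are `u`, `p` with `u ∈ C^∞(ℝ³ × [0,∞))` solving (1)–(3) with `f ≡ 0`, `u(0) = u₀`. (Pressure regularity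
and energy are not printed — see `ClayDelta`.) [cite: Feinstein2025, Thm 7.1 main p.3; abstract p.1]
[claim: Feinstein2025, status: under-review] -/
def ClaimedTheorem : Prop :=
  ∀ ν : ℝ, 0 < ν → ∀ u₀ : E3 → E3, ContDiff ℝ ∞ u₀ → NSWave0.IsDivFree u₀ → HasRapidSpatialDecay u₀ →
    ∃ (u : ℝ → E3 → E3) (p : ℝ → E3 → ℝ), IsSmoothOnHalfSpace u ∧ IsNavierStokesSolution ν 0 u₀ u p

/-! ## The printed composition at the abstract grain (real functions of time) -/

/-- **Step 3 — proof of Theorem 7.1, line 1, main p.3** («From Theorem 6.2 … Grönwall yields F(t) < ∞»;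
= app. §7 p.4), AS USED: let `F ≥ 0` on `(0,T)` (the functional of Def. 3.2), `D ≥ 0` (the dissipative
sum), `Φ ≥ 0` integrable on `(0,T)` (Step 2, app. §5), `c, C ≥ 0`, and suppose the CLI inequality of
Theorem 6.2 `F' + c D ≤ C Φ F` holds at every time of the GOOD set `G ⊆ (0,T)` (Standing Assumption 2.1,
main p.2). Then `F` is bounded on `(0,T)`. (For `G = (0,T)` this is Grönwall; the print never shows
`G = (0,T)`.) [cite: Feinstein2025, Thm 7.1 proof main p.3; Thm 6.2 main p.3; Assumption 2.1 main p.2; app. §7 p.4] -/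
def Step3_GronwallOnGoodSlabs_abs : Prop :=
  ∀ (T c C : ℝ) (F D Φ F' : ℝ → ℝ) (G : Set ℝ), 0 < T → 0 ≤ c → 0 ≤ C →
    (∀ t ∈ Ioo 0 T, 0 ≤ F t) → (∀ t ∈ Ioo 0 T, 0 ≤ D t) → (∀ t ∈ Ioo 0 T, 0 ≤ Φ t) →
    IntegrableOn Φ (Ioo 0 T) → G ⊆ Ioo 0 T →
    (∀ t ∈ G, HasDerivAt F (F' t) t ∧ F' t + c * D t ≤ C * Φ t * F t) →
      ∃ M : ℝ, ∀ t ∈ Ioo 0 T, F t ≤ M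

/-- **Step 4 — proof of Theorem 7.1, «conic Bernstein estimate ‖ω‖_{L^∞} ≲ F(t) … integrability of
‖ω‖_{L^∞}»**, abstract grain: a measurable `w ≥ 0` dominated by `K·F` with `F` bounded on `(0,T)` is
integrable on `(0,T)`. [cite: Feinstein2025, Thm 7.1 proof main p.3; app. §7 p.4] -/
def Step4_BernsteinBKM_abs : Prop :=
  ∀ (T K : ℝ) (F w : ℝ → ℝ), 0 < T → 0 ≤ K → AEStronglyMeasurable w (volume : Measure ℝ) →
    (∀ t ∈ Ioo 0 T, 0 ≤ w t ∧ w t ≤ K * F t) → (∃ M : ℝ, ∀ t ∈ Ioo 0 T, F t ≤ M) →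
      IntegrableOn w (Ioo 0 T)

/-- **Step 5 — the bridge** («Beale–Kato–Majda implies smooth continuation. Thus u ∈ C^∞(ℝ³ × [0,∞))»,
main p.3; app. §7 p.4 «triggers the Beale–Kato–Majda/Kozono–Taniuchi continuation criterion»): the two
abstract moves, applied to the paper's `F`, `Φ`, `ω` of every solution, give Theorem 7.1 (BKM and the
local theory are invoked, not printed). [cite: Feinstein2025, Thm 7.1 proof main p.3; app. §7 p.4] -/
def Step5_Bridge : Prop := Step3_GronwallOnGoodSlabs_abs ∧ Step4_BernsteinBKM_abs → ClaimedTheorem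

/-- The chain as printed; every binder consumed. [cite: Feinstein2025, Thm 7.1 main p.3] -/
theorem claim_of_steps (h3 : Step3_GronwallOnGoodSlabs_abs) (h4 : Step4_BernsteinBKM_abs)
    (h5 : Step5_Bridge) : ClaimedTheorem :=
  h5 ⟨h3, h4⟩

/-- RECORD: Step 4 holds (domination by a bounded function on a finite interval).
[cite: Feinstein2025, Thm 7.1 proof main p.3] -/
theorem step4_holds : Step4_BernsteinBKM_abs := by
  intro T K F w hT hK hw hdom hbd
  obtain ⟨M, hM⟩ := hbd
  have hfin : volume (Ioo (0 : ℝ) T) ≠ ⊤ := by simp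
  refine Measure.integrableOn_of_bounded (M := K * M) hfin hw ?_
  filter_upwards [ae_restrict_mem measurableSet_Ioo] with t ht
  obtain ⟨h0, h1⟩ := hdom t ht
  rw [Real.norm_eq_abs, abs_of_nonneg h0]
  exact h1.trans (mul_le_mul_of_nonneg_left (hM t ht) hK)

/-- RECORD (Δ7): once Step 3 fails (typist kit `not_Step3_GronwallOnGoodSlabs_abs`), the bridge holds
vacuously — the first failing step in dependency order is Step 3. [cite: Feinstein2025, Thm 7.1 main p.3] -/
theorem step5_of_not_step3 (h : ¬ Step3_GronwallOnGoodSlabs_abs) : Step5_Bridge :=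
  fun h34 => absurd h34.1 h

/-! ## Clay delta -/

/-- **The unprinted gap to (A)**: the pressure is smooth on the closed half-space and the energy is
bounded ((A) (6)–(7)); Theorem 7.1 prints neither. [cite: Feinstein2025, Thm 7.1 main p.3] -/
def ClayDelta : Prop :=
  ∀ (ν : ℝ) (u₀ : E3 → E3) (u : ℝ → E3 → E3) (p : ℝ → E3 → ℝ), 0 < ν →
    ContDiff ℝ ∞ u₀ → NSWave0.IsDivFree u₀ → HasRapidSpatialDecay u₀ →
    IsSmoothOnHalfSpace u → IsNavierStokesSolution ν 0 u₀ u p →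
      IsSmoothOnHalfSpace p ∧ HasBoundedEnergy u

/-- Transfer: the claim plus the delta give Clay (A). [cite: Feinstein2025, Thm 7.1 main p.3] -/
theorem clay_of_claimed_of_delta (h : ClaimedTheorem) (hΔ : ClayDelta) : clayR3.Regularity := by
  intro ν hν u₀ hs hdiv hdec
  obtain ⟨u, p, hu, hsol⟩ := h ν hν u₀ hs hdiv hdec
  obtain ⟨hp, hE⟩ := hΔ ν u₀ u p hν hs hdiv hdec hu hsol
  exact ⟨u, p, hu, hp, hsol, hE⟩

end Literature.Claims.NS.Feinstein2025
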